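import Summits.QuantumFields.YangMills.Theorems.IR.ColdDefectFiniteAbelian
import Literature.Barriers.QuantumFields.DiscreteSubgroupFreezing
import HarnessLib

/-!
# THE NUMBER's currency at the cyclic gauge groups `ℤ_n ⊂ U(1)`: the cold box is never `1/24`-pure at large `β` (helper for stmt-QuantumFields-26930)

Instance file of `ColdDefectFiniteAbelian` (p784277) for the barrier catalogue's discrete subgroups `rootsOfUnityCircle n ⊂ U(1)` with their Wilson
representation `znRep n` (`Literature.Barriers.QuantumFields.DiscreteSubgroupFreezing`): for every `n ≥ 2` and every box `L ≥ 4`,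
`coldDefect (znRep n) β L → 1 − |ℤ_n|⁻³` and `coldDefect (znRep n) β L > 1/24` for all large `β` — THE NUMBER's purity test fails at every
fixed box along the whole discrete family `ℤ_n ↑ U(1)` of the `DiscreteSubgroupFreezing` barrier (and the freezing limits `1 − |ℤ_n|⁻³ ↑ 1`).
LEAD prover `ymfull-r2c-lead-1` g0, cell `ym-gapexp`, `--supports stmt-QuantumFields-26930`; BC5 ∕ calibration side only — nothing here proves
`PinnedExitsCofinalAt`, `IRcof`, `IR`, or the Yang–Mills mass gap.  Def-free.
-/

set_option autoImplicit false

noncomputable section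

open Filter Topology MeasureTheory
open Literature.MathematicalPhysics.QuantumFieldTheory Literature.MathematicalPhysics.QuantumLattice
open Literature.Barriers.QuantumFields
open Summit.QuantumFields.YangMills.Cruxes.IR.ColdPurityBridge (coldDefect)

namespace Summit.QuantumFields.YangMills.Cruxes.IR.FreezingLimit

/-- The Wilson character of `ℤ_n ⊂ U(1)` detects the identity: `Re tr znRep(z) = 1 ↔ z = 1` (faithful, unitary). -/
theorem re_trace_znRep_eq_iff (n : ℕ) (z : rootsOfUnityCircle n) : (znRep n z).trace.re = (1 : ℕ) ↔ z = 1 :=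
  re_trace_eq_iff_eq_one (znRep n) (znRep_mem_unitaryGroup n) (znRep_injective n) z

/-- **`ℤ_n`: THE NUMBER's currency freezes at `1 − |ℤ_n|⁻³`** — for `n ≥ 2` and every box `L ≥ 4`,
`coldDefect (znRep n) β L → 1 − (card ℤ_n)⁻³` as `β → ∞`. -/
theorem tendsto_coldDefect_atTop_zn (n : ℕ) [Fact (2 ≤ n)] [Fintype (rootsOfUnityCircle n)] {L : ℕ} (hL : 4 ≤ L) :
    Tendsto (fun β : ℝ => coldDefect (znRep n) β L) atTop
      (𝓝 (1 - ((Fintype.card (rootsOfUnityCircle n) : ℝ) ^ 3)⁻¹)) := by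
  haveI : NeZero n := ⟨by have := (Fact.out : 2 ≤ n); omega⟩
  exact tendsto_coldDefect_atTop_finite_abelian (znRep n) (re_trace_znRep_eq_iff n) hL

/-- **`ℤ_n`: the cold box is never `1/24`-pure at large `β`** — for `n ≥ 2` and every `L ≥ 4`, `1/24 < coldDefect (znRep n) β L` for all
sufficiently large `β` (the purity test of THE NUMBER fails at every fixed box along the whole discrete family `ℤ_n ⊂ U(1)`). -/
theorem eventually_one_div_24_lt_coldDefect_zn (n : ℕ) [Fact (2 ≤ n)] {L : ℕ} (hL : 4 ≤ L) :
    ∀ᶠ β : ℝ in atTop, (1 : ℝ) / 24 < coldDefect (znRep n) β L := by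
  haveI : NeZero n := ⟨by have := (Fact.out : 2 ≤ n); omega⟩
  haveI : Fintype (rootsOfUnityCircle n) := Fintype.ofFinite _
  exact eventually_one_div_24_lt_coldDefect (znRep n) (re_trace_znRep_eq_iff n) hL

end Summit.QuantumFields.YangMills.Cruxes.IR.FreezingLimit

end
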